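import Literature.MathematicalPhysics.QuantumFieldTheory.Balaban1983to89.B7Eq123General
import Literature.MathematicalPhysics.QuantumFieldTheory.Balaban1983to89.B8Eq155JBound

/-!
# `Balaban1983to89.B8Eq156Prop4` — T. Bałaban, *Spaces of regular gauge field configurations on a lattice and gauge
# fixing conditions*, Commun. Math. Phys. **99** (1985) 75–102 [Balaban1985RegularSpaces], p. 86: the step (1.56)
# «Proposition 4 from [3] implies Q_j(U₀, ηA) = LʲηQ_jA + C_j(LʲηA), |C_j(LʲηA)| ≦ C₂|LʲηA|² < C₂α₂²» and the sentence
# «hence LʲηQ_jA = B₁, B₁ = B − C_j(LʲηA) on Λ_j, |B₁| < 2dLα₁ + C₂α₂²», PROVED on the `ℤᵈ` carriers from [3] Prop. 4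
# at a general background, and fed into the bootstrap (1.55)–(1.60)

statement-level skeleton of published theorems with citation tags; proofs where landed; nothing here is a claim about the Yang–Mills mass gap

PDF held: `paper:balaban1985-cmp99-regular-spaces-gauge-fixing` (journal page = PDF page + 74); page read for this module AS
IMAGE: render `run/shared/lean/pub/pub-balaban/b2b-balaban-ref1/pages/1985-cmp99-regular-spaces-gauge-fixing/…-p012-x2.png`
(p. 86, (1.55)–(1.61)); [3] = T. Bałaban, *Averaging operations for lattice gauge theories*, Commun. Math. Phys. **98** (1985)
17–51 [Balaban1985Averaging], Prop. 4 (130)–(135) pp. 38–39, through the tree module `B7Eq123General` (its docstring quotes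
the renders `1985-cmp98-averaging-p022-x2.png`, `-p023`).

CITATION HEADER (lean-in-tree rule).  Cell `lit-balaban` (HOME `run/shared/lean/pub/lit-balaban/`), unit `lit-balaban-p40`
gen 3 (Phase-2 proof seat p40; B8 fold owner r05, referee ref-4).  WHAT IS REPRODUCED = SKELETON row **`B8.Eq1.56`** ((1.56)
p. 86; cell status «typed-existing — hypothesis `h56` of `B8.apriori_160` / `B8Eq155JBound.apriori_160_of_155`
(`nB ≤ 2dLα₁ + C₂α₂²`)»): the display (1.56) and the sentence after it PROVED for the concrete objects of the tree —
`Q_j(U₀, ηA)` = `B7Prop4GeneralLevels.logCovIter` (the composite (127) of [3] of the one-step maps (121), whose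
exponential IS the double-bar average `(U₁U₀)‾ʲ(Ū₀ʲ)⁻¹` by `B7Eq123General.dbavgCovIter_eq_expCfg_logCovIter`),
`LʲηQ_jA` = `B7Prop4GeneralLevels.linCovIter` (the composite of the linear parts (122)), `C_j(LʲηA)` = their difference —
from the KERNEL THEOREM `B7Eq123General.prop4_general` (seat p06 gen 2, p246433: [3] Prop. 4 (130)–(131) at a general
regular background, k-uniform, unconditional) with the explicit constant `C₂ = C₂(d, α₀) = 8C₁e^{4cα₀}`,
`C₁ = 131072(d+1)²`, `c = 800(d+1)²(d+4)` («C₂ depends on d», [3] p. 39; `e^{4cα₀} ≤ 2` in the admissible range); and the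
real hypothesis `h56` of the tree's bootstrap `B8Eq155JBound.apriori_160_of_155` ((1.55) ⇒ (1.59) ⇒ (1.60)) DISCHARGED by
it (`apriori_160_of_156`).  Kind «kernel-checked proof», theorems only; no `… : Prop` fact, no definition; no existing module
is modified; REUSED BY NAME: `B7Eq123General.prop4_general`, `B7Prop4GeneralLevels.logCovIter/linCovIter`,
`B7Prop2Explicit.pdev/AvgClosed/C0/c2'/le_pdev`, `B7Prop3Flat.c3`, `B8Eq146AExpansion.iEta/expCfg/norm_iEta_le`,
`B8Eq155JBound.wsup/wsup_le/jNorm3/gradNorm2/apriori_160_of_155`, `B8Ineq132.plaqF/covDiv`, `B8Lemma1NonAbelian.mulCfg`,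
`B7Prop1Explicit.Site/U1`.

WHAT IS PRINTED (p. 86 [PDF 12], verbatim, from the render).  *"The configuration A satisfies (1.42) also. Proposition 4
from [3] implies that
Q_j(U₀, ηA) = LʲηQ_jA + C_j(LʲηA), |C_j(LʲηA)| ≦ C₂|LʲηA|² < C₂α₂², (1.56)
hence LʲηQ_jA = B₁, B₁ = B − C_j(LʲηA) on Λ_j, |B₁| < 2dLα₁ + C₂α₂². We make the translation A = A₁ + H(U₀)B₁, where
the operator H(U₀) was defined in [4], and we get the equations …"*; the standing hypotheses (p. 83 [PDF 9]): *"U₀, U₁U₀ ∈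
𝔄_k({Ω_j}, α₀), U₀ satisfies the additional regularity condition (3.35) in [4], (1.40) U₁ = e^{iηA}, |A| < α₂(Lʲη)⁻¹ on
Ω_j, (1.41) R(U₀)D^{η*}_{U₀}A = 0, Q_j(U₀, ηA) = B on Λ_j, |B| < 2dLα₁, (1.42)"*, with (Proposition 3, p. 87) *"α₀, α₁, α₂
bounded by a constant depending on d and L only"*.  [3] Prop. 4, pp. 38–39 [PDF 22–23], verbatim (quoted in
`B7Eq123General`/`B7Prop4GeneralLevels`): *"|Q_j(U₀, ηA) − LʲηQ_j(U₀)A| < e^{O(1)(L^{2(j−1)}+…+L²)η²α₀}4C₁(L^{j−1} + … +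
1)Lʲη²α₁², (130) |Q_j(U₀, ηA)| < 2α₁Lʲη (131) for j = 1, …, k"*, *"Q_k(U₀, ηA) = Q_k(U₀)A + C_k(U₀, A), (134) and
|C_k(U₀, A)| ≦ C₂|A|² < C₂α₁². (135)"*, *"The constants C₂, c₄ are independent of k, C₂ depends on d and c₄ depends on
d and L."*

DICTIONARY (the `ℤᵈ` model of the two parent lineages; nothing new).  Sites `Site d = Fin d → ℤ`, bond fields
`A : Site d → Fin d → 𝔸` over a complete normed `ℂ`-algebra `𝔸` with `‖1‖ = 1`, `U₀ : Site d → Fin d → 𝔸ˣ` with values in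
an averaging-closed gauge group `G ≤ U1 𝔸` (`B7Prop2Explicit.AvgClosed`, e.g. the unitary group of a C⋆-algebra,
`avgClosed_unitaryUnits`); the B7 lineage absorbs `i` and `η` into the exponent field: print's `ηA` with `U₁ = e^{iηA}` ↦
`B = iEta η A` (`= iηA`, `B8Eq146AExpansion.iEta`), so that print's `Q_j(U₀, ηA)` ↦ `(1/i)·logCovIter L U₀ (iEta η A) j`,
`LʲηQ_jA` ↦ `(1/i)·linCovIter L U₀ (iEta η A) j`, `C_j(LʲηA)` ↦ `(1/i)·(logCovIter − linCovIter)` — the factor `1/i` is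
invisible in every norm statement below (`‖iX‖ = ‖X‖`), and the identities are stated for the `i`-multiplied objects.  A
bond of the `Lʲη`-lattice `T^{(j)}` ↦ a pair `(z, κ)`, `z ∈ ℤᵈ` (the unit lattice after `j` rescalings, B7 lineage); «on
Λ_j» ↦ an indexed family `bond : ι → Site d × Fin d` of such pairs (any index type).  (1.40) for `U₀` at the level `j` ↦
`pdev U₀ < α₀·(Lʲ)⁻²` (= (1.7)/(1.8) `|U₀(∂p) − 1| < α₀L^{−2j} = α₀η²(Lʲη)⁻²`, read GLOBALLY on `ℤᵈ` — lineage convention,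
HONEST SCOPE (ii)); (1.41) ↦ `‖A y κ‖ ≤ α₂(Lʲη)⁻¹` globally; (1.42), second clause ↦ `‖logCovIter L U₀ (iEta η A) j z κ‖ <
2dLα₁` on the family `bond`; `B₁` on `Λ_j` ↦ `linCovIter L U₀ (iEta η A) j` on the family; `|B₁|` ↦ the sup
`B8Eq155JBound.wsup 1 (B₁ ∘ bond)`.

WHAT THIS FILE PROVES (kernel, no `sorry`, axioms ⊆ {propext, Classical.choice, Quot.sound}).
* **`eq156`** — (1.56) for a general exponent field `B` at the level `j`: under [3] Prop. 2's smallness on `U₀`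
  (`C₀α₀ ≤ 1/3`, `4α₀ ≤ c₂′(d, L)`, `pdev U₀ < α₀(Lʲ)⁻²`) and `sup‖B‖ ≤ b` with `e^{4cα₀}(1 + 8C₁Lʲb) ≤ 2`, `2Lʲb ≤ c₃(d, L)`:
  `Q_j = LʲηQ_j + C_j` (by definition of the difference) and `‖C_j(z, κ)‖ ≤ C₂(d, α₀)·(Lʲb)²` at every coarse bond —
  `B7Eq123General.prop4_general` at `k = j`, read at its own top level; `norm_logCovIter_le` records the companion [3] (131)
  `‖Q_j‖ ≤ 2Lʲb` in the same setting.
* **`eq156_A`** — the same in B8's currency `B = iηA`, `sup|A| ≤ a`: `‖C_j(LʲηA)‖ ≤ C₂·(Lʲηa)²` = «|C_j(LʲηA)| ≦ C₂|LʲηA|²»;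
  **`eq156_of_141`** — under (1.41) `|A| ≤ α₂(Lʲη)⁻¹`: `‖C_j(LʲηA)‖ ≤ C₂α₂²` = «< C₂α₂²», smallness now `e^{4cα₀}(1 + 8C₁α₂) ≤ 2`,
  `2α₂ ≤ c₃(d, L)` («α₀, α₂ bounded by a constant depending on d and L only»).
* **`B1_eq`**, **`norm_B1_lt`** — the sentence: `B₁ := LʲηQ_jA = Q_j(U₀, ηA) − C_j(LʲηA)` and, on every bond where (1.42)
  `‖Q_j(U₀, ηA)‖ < 2dLα₁` holds, `‖B₁‖ < 2dLα₁ + C₂α₂²`; **`wsup_B1_le`** — hence `|B₁| ≤ 2dLα₁ + C₂α₂²` for the sup over any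
  family of such bonds (= the hypothesis `h56` of `B8.apriori_160`, with `C₂ = C₂(d, α₀)`).
* **`apriori_160_of_156`** — the tree's bootstrap `B8Eq155JBound.apriori_160_of_155` ((1.55) certified there, (1.59) =
  Theorem 3.3 of [4] as the four real hypotheses `h59a/h59g/h59j/h59l`, «B₀36dα₂ ≦ 1/2», `50dα₂ ≤ 1`) with `h56` NO LONGER A
  HYPOTHESIS: `nB := |B₁|` is the sup above and (1.56) supplies its bound; the plaquette input `hp` of (1.55) and the
  `U1`-valuedness of `U₀` are read off the single (1.40) hypothesis `pdev U₀ < α₀(Lʲ)⁻²` and `G ≤ U1`.  Output: the four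
  bounds (1.60) with `C₂ = C₂(d, α₀)`.
* (v1.1, §5) **`ineq1143`** — p. 100 (1.143) «The Proposition 4 from [3] gives also |Q_j(U₀, ηA)| < 2α₂ on Ω_j^{(j)}» under
  (1.139) and the first member of (1.140) (= [3] (131) @gen, in B8's currency; the cell's row `B8.Eq1.141` had «(1.143) enters
  as hypothesis»); **`apriori_160_of_156_unitary`** — print's own setting: `U₀` unitary-valued in a non-trivial C⋆-algebra
  (`avgClosed_unitaryUnits`) and `A` self-adjoint, so that also the two `U₁ = e^{iηA}` hypotheses (`U1`-valued, `|U₁ − 1| ≤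
  α₂(Lʲη)⁻¹η`) of the bootstrap are discharged (`B8Eq155JBound` §5).
HONEST SCOPE.  (i) `C₂` is p06's explicit `8C₁e^{4cα₀}` (a function of `d` and `α₀`; `≤ 16C₁` since `e^{4cα₀} ≤ 2` is part
of the smallness) — print's «C₂ depends on d».  (ii) GLOBAL READING (lineage convention of `B7Eq123General`,
`B8Eq155JBound`, cell GAPS G-adv8-11): (1.40), (1.41) are assumed on all of `ℤᵈ` at the level `j` at which (1.56) is
applied, whereas print assumes them on `Ω_j` and uses the locality of `Q_j` («Q_j(U₀, ηA) restricted to Λ_j depends on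
A restricted to Bʲ(Λ_j) ⊂ Ω_j»); the multi-level statement is the conjunction over `j` of these one-level statements only
when the hypotheses hold globally at every level.  (iii) (1.42)'s first clause (the Landau gauge) and the translation
(1.57)–(1.58), the operator `G(U₀)` and Theorem 3.3 of [4] ((1.59)) are NOT used/typed here — (1.59) stays the four real
hypotheses of `apriori_160_of_155`; this file removes exactly one hypothesis, `h56`.  (iv) Strict `<` of print certified as
`≤` except in `norm_B1_lt` (strict, from the strict (1.42)).  (v) Nothing here is progress on the summit
`Summit.QuantumFields` — the value is a kernel certificate that the B7-Prop.-4 input of B8's Sect. C bootstrap is a theorem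
of the tree.  Unit `lit-balaban-p40` gen 3, 2026-08-21.

VERSIONS.  v1 p248436 (§§1–4); v1.1 (§5: `ineq1143`, `apriori_160_of_156_unitary`; append-only) — unit `lit-balaban-p40` gen 3.

[cite: Balaban1985RegularSpaces, (1.56) p.86; (1.40)–(1.42) p.83; (1.55)–(1.60) p.86; (1.139)–(1.140), (1.143) p.100;
Balaban1985Averaging, Prop. 4 (130)–(131) p.38, (134)–(135) p.39]
-/

noncomputable section

open scoped BigOperators
open NormedSpace

namespace Literature.MathematicalPhysics.QuantumFieldTheory.Balaban1983to89.B8Eq156Prop4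

open B7Prop1Explicit (U1)
open B7Prop2Explicit (pdev AvgClosed C0 c2' le_pdev)
open B7Prop3Flat (c3)
open B7Prop4GeneralLevels (logCovIter linCovIter)
open B7Eq123General (prop4_general)
open B8Lemma1NonAbelian (mulCfg)
open B8Ineq132 (plaqF covDiv)
open B8Eq146AExpansion (iEta expCfg norm_iEta_le)
open B8Eq155JBound (wsup wsup_le jNorm3 gradNorm2 apriori_160_of_155)

-- `Site` alone would resolve to the torus sites of `Setup.lean`; re-export the `ℤ^d` sites of `B7Prop1Explicit`.
export B7Prop1Explicit (Site)

variable {d : ℕ} {𝔸 : Type*} [NormedRing 𝔸] [NormOneClass 𝔸] [NormedAlgebra ℂ 𝔸] [CompleteSpace 𝔸]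

/-! ## §1 (1.56) at the level `j`, for a general exponent field `B` (the [3] currency, `B = iηA`) -/

/-- **(1.56), first half, [3] currency.**  «Proposition 4 from [3] implies that Q_j(U₀, ηA) = LʲηQ_jA + C_j(LʲηA),
|C_j(LʲηA)| ≦ C₂|LʲηA|²»: for `U₀` with values in an averaging-closed `G ≤ U1` satisfying [3] Prop. 2's smallness with
`pdev U₀ < α₀(Lʲ)⁻²` ((1.40) at the level `j`) and an exponent field with `sup‖B‖ ≤ b`, `e^{4cα₀}(1 + 8C₁Lʲb) ≤ 2`,
`2Lʲb ≤ c₃(d, L)`: at every bond of the `j`-lattice `Q_j = LʲηQ_j + C_j` and `‖C_j‖ ≤ C₂·(Lʲb)²`, `C₂ = 8C₁e^{4cα₀}` —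
`B7Eq123General.prop4_general` at `k = j`. [cite: Balaban1985RegularSpaces, (1.56) p.86] -/
theorem eq156 (L : ℕ) (hL : 2 ≤ L) {G : Subgroup 𝔸ˣ} (hG : AvgClosed d L G) (j : ℕ)
    (U₀ : Site d → Fin d → 𝔸ˣ) (hU₀ : ∀ x κ, U₀ x κ ∈ G) {α₀ : ℝ} (hα₀ : 0 < α₀)
    (hα3 : C0 d * α₀ ≤ 1 / 3) (hα4 : 4 * α₀ ≤ c2' d L) (h40 : pdev U₀ < α₀ * (((L : ℝ) ^ j)⁻¹) ^ 2)
    (B : Site d → Fin d → 𝔸) {b : ℝ} (hb : 0 ≤ b) (hB : ∀ x κ, ‖B x κ‖ ≤ b)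
    (hsmall : Real.exp (4 * (800 * ((d : ℝ) + 1) ^ 2 * ((d : ℝ) + 4)) * α₀)
      * (1 + 8 * (131072 * ((d : ℝ) + 1) ^ 2) * ((L : ℝ) ^ j * b)) ≤ 2)
    (hc₃ : 2 * ((L : ℝ) ^ j * b) ≤ c3 d L) (z : Site d) (κ : Fin d) :
    logCovIter L U₀ B j z κ = linCovIter L U₀ B j z κ + (logCovIter L U₀ B j z κ - linCovIter L U₀ B j z κ) ∧
      ‖logCovIter L U₀ B j z κ - linCovIter L U₀ B j z κ‖
        ≤ 8 * (131072 * ((d : ℝ) + 1) ^ 2) * Real.exp (4 * (800 * ((d : ℝ) + 1) ^ 2 * ((d : ℝ) + 4)) * α₀)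
          * ((L : ℝ) ^ j * b) ^ 2 :=
  ⟨(add_sub_cancel _ _).symm, (prop4_general L hL hG j U₀ hU₀ hα₀ hα3 hα4 h40 B hb hB hsmall hc₃ j le_rfl).1 z κ⟩

/-- [3] (131) at the level `j` in the same setting: `‖Q_j(U₀, ηA)‖ ≤ 2Lʲb` (recorded for the users of (1.56); print uses it on
p. 100, (1.143)). [cite: Balaban1985RegularSpaces, (1.56) p.86] -/
theorem norm_logCovIter_le (L : ℕ) (hL : 2 ≤ L) {G : Subgroup 𝔸ˣ} (hG : AvgClosed d L G) (j : ℕ)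
    (U₀ : Site d → Fin d → 𝔸ˣ) (hU₀ : ∀ x κ, U₀ x κ ∈ G) {α₀ : ℝ} (hα₀ : 0 < α₀)
    (hα3 : C0 d * α₀ ≤ 1 / 3) (hα4 : 4 * α₀ ≤ c2' d L) (h40 : pdev U₀ < α₀ * (((L : ℝ) ^ j)⁻¹) ^ 2)
    (B : Site d → Fin d → 𝔸) {b : ℝ} (hb : 0 ≤ b) (hB : ∀ x κ, ‖B x κ‖ ≤ b)
    (hsmall : Real.exp (4 * (800 * ((d : ℝ) + 1) ^ 2 * ((d : ℝ) + 4)) * α₀)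
      * (1 + 8 * (131072 * ((d : ℝ) + 1) ^ 2) * ((L : ℝ) ^ j * b)) ≤ 2)
    (hc₃ : 2 * ((L : ℝ) ^ j * b) ≤ c3 d L) (z : Site d) (κ : Fin d) :
    ‖logCovIter L U₀ B j z κ‖ ≤ 2 * ((L : ℝ) ^ j * b) :=
  (prop4_general L hL hG j U₀ hU₀ hα₀ hα3 hα4 h40 B hb hB hsmall hc₃ j le_rfl).2 z κ

/-! ## §2 (1.56) in B8's currency: `B = iηA`, (1.41) `|A| < α₂(Lʲη)⁻¹` -/

/-- **(1.56), «|C_j(LʲηA)| ≦ C₂|LʲηA|²»** for `U₁ = e^{iηA}` with `sup|A| ≤ a`: `‖C_j(LʲηA)(z, κ)‖ ≤ C₂·(Lʲη·a)²`, under the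
smallness `e^{4cα₀}(1 + 8C₁·Lʲηa) ≤ 2`, `2Lʲηa ≤ c₃(d, L)`. [cite: Balaban1985RegularSpaces, (1.56) p.86] -/
theorem eq156_A {η : ℝ} (hη : 0 ≤ η) (L : ℕ) (hL : 2 ≤ L) {G : Subgroup 𝔸ˣ} (hG : AvgClosed d L G) (j : ℕ)
    (U₀ : Site d → Fin d → 𝔸ˣ) (hU₀ : ∀ x κ, U₀ x κ ∈ G) {α₀ : ℝ} (hα₀ : 0 < α₀)
    (hα3 : C0 d * α₀ ≤ 1 / 3) (hα4 : 4 * α₀ ≤ c2' d L) (h40 : pdev U₀ < α₀ * (((L : ℝ) ^ j)⁻¹) ^ 2)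
    (A : Site d → Fin d → 𝔸) {a : ℝ} (ha : 0 ≤ a) (hA : ∀ y κ, ‖A y κ‖ ≤ a)
    (hsmall : Real.exp (4 * (800 * ((d : ℝ) + 1) ^ 2 * ((d : ℝ) + 4)) * α₀)
      * (1 + 8 * (131072 * ((d : ℝ) + 1) ^ 2) * ((L : ℝ) ^ j * η * a)) ≤ 2)
    (hc₃ : 2 * ((L : ℝ) ^ j * η * a) ≤ c3 d L) (z : Site d) (κ : Fin d) :
    ‖logCovIter L U₀ (iEta η A) j z κ - linCovIter L U₀ (iEta η A) j z κ‖
      ≤ 8 * (131072 * ((d : ℝ) + 1) ^ 2) * Real.exp (4 * (800 * ((d : ℝ) + 1) ^ 2 * ((d : ℝ) + 4)) * α₀)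
        * ((L : ℝ) ^ j * η * a) ^ 2 := by
  have hmul : (L : ℝ) ^ j * (η * a) = (L : ℝ) ^ j * η * a := by ring
  have h := (eq156 L hL hG j U₀ hU₀ hα₀ hα3 hα4 h40 (iEta η A) (mul_nonneg hη ha) (norm_iEta_le hη hA)
    (by rw [hmul]; exact hsmall) (by rw [hmul]; exact hc₃) z κ).2
  rwa [hmul] at h

/-- **(1.56), «… < C₂α₂²»**, under (1.41) `|A| ≤ α₂(Lʲη)⁻¹` read globally (`η > 0`): `‖C_j(LʲηA)(z, κ)‖ ≤ C₂α₂²`,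
smallness `e^{4cα₀}(1 + 8C₁α₂) ≤ 2`, `2α₂ ≤ c₃(d, L)` («α₀, α₂ bounded by a constant depending on d and L only», p. 87).
[cite: Balaban1985RegularSpaces, (1.56) p.86] -/
theorem eq156_of_141 {η : ℝ} (hη : 0 < η) (L : ℕ) (hL : 2 ≤ L) {G : Subgroup 𝔸ˣ} (hG : AvgClosed d L G) (j : ℕ)
    (U₀ : Site d → Fin d → 𝔸ˣ) (hU₀ : ∀ x κ, U₀ x κ ∈ G) {α₀ : ℝ} (hα₀ : 0 < α₀)
    (hα3 : C0 d * α₀ ≤ 1 / 3) (hα4 : 4 * α₀ ≤ c2' d L) (h40 : pdev U₀ < α₀ * (((L : ℝ) ^ j)⁻¹) ^ 2)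
    (A : Site d → Fin d → 𝔸) {α₂ : ℝ} (hα₂ : 0 ≤ α₂) (h41 : ∀ y κ, ‖A y κ‖ ≤ α₂ * ((L : ℝ) ^ j * η)⁻¹)
    (hsmall : Real.exp (4 * (800 * ((d : ℝ) + 1) ^ 2 * ((d : ℝ) + 4)) * α₀)
      * (1 + 8 * (131072 * ((d : ℝ) + 1) ^ 2) * α₂) ≤ 2)
    (hc₃ : 2 * α₂ ≤ c3 d L) (z : Site d) (κ : Fin d) :
    ‖logCovIter L U₀ (iEta η A) j z κ - linCovIter L U₀ (iEta η A) j z κ‖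
      ≤ 8 * (131072 * ((d : ℝ) + 1) ^ 2) * Real.exp (4 * (800 * ((d : ℝ) + 1) ^ 2 * ((d : ℝ) + 4)) * α₀)
        * α₂ ^ 2 := by
  have hL0 : (0 : ℝ) < (L : ℝ) ^ j := by positivity
  have hscale : (L : ℝ) ^ j * η * (α₂ * ((L : ℝ) ^ j * η)⁻¹) = α₂ := by
    field_simp
  have ha : 0 ≤ α₂ * ((L : ℝ) ^ j * η)⁻¹ := mul_nonneg hα₂ (inv_nonneg.2 (by positivity))
  have h := eq156_A hη.le L hL hG j U₀ hU₀ hα₀ hα3 hα4 h40 A ha h41 (by rw [hscale]; exact hsmall)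
    (by rw [hscale]; exact hc₃) z κ
  rwa [hscale] at h

/-! ## §3 «hence LʲηQ_jA = B₁, B₁ = B − C_j(LʲηA) on Λ_j, |B₁| < 2dLα₁ + C₂α₂²» -/

omit [NormOneClass 𝔸] in
/-- **`B₁ = B − C_j(LʲηA)`**: at every bond, `LʲηQ_jA = Q_j(U₀, ηA) − C_j(LʲηA)` (so where (1.42) puts `Q_j(U₀, ηA) = B`, the
linear part is `B − C_j(LʲηA)`). [cite: Balaban1985RegularSpaces, p.86 (sentence after (1.56))] -/
theorem B1_eq (L : ℕ) (U₀ : Site d → Fin d → 𝔸ˣ) (B : Site d → Fin d → 𝔸) (j : ℕ) (z : Site d) (κ : Fin d) :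
    linCovIter L U₀ B j z κ = logCovIter L U₀ B j z κ - (logCovIter L U₀ B j z κ - linCovIter L U₀ B j z κ) :=
  (sub_sub_cancel _ _).symm

/-- **«|B₁| < 2dLα₁ + C₂α₂²»** at one bond of `Λ_j`: if (1.42) `‖Q_j(U₀, ηA)(z, κ)‖ < 2dLα₁` then, by (1.56),
`‖LʲηQ_jA(z, κ)‖ < 2dLα₁ + C₂α₂²`. [cite: Balaban1985RegularSpaces, p.86 (sentence after (1.56))] -/
theorem norm_B1_lt {η : ℝ} (hη : 0 < η) (L : ℕ) (hL : 2 ≤ L) {G : Subgroup 𝔸ˣ} (hG : AvgClosed d L G) (j : ℕ)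
    (U₀ : Site d → Fin d → 𝔸ˣ) (hU₀ : ∀ x κ, U₀ x κ ∈ G) {α₀ : ℝ} (hα₀ : 0 < α₀)
    (hα3 : C0 d * α₀ ≤ 1 / 3) (hα4 : 4 * α₀ ≤ c2' d L) (h40 : pdev U₀ < α₀ * (((L : ℝ) ^ j)⁻¹) ^ 2)
    (A : Site d → Fin d → 𝔸) {α₂ : ℝ} (hα₂ : 0 ≤ α₂) (h41 : ∀ y κ, ‖A y κ‖ ≤ α₂ * ((L : ℝ) ^ j * η)⁻¹)
    (hsmall : Real.exp (4 * (800 * ((d : ℝ) + 1) ^ 2 * ((d : ℝ) + 4)) * α₀)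
      * (1 + 8 * (131072 * ((d : ℝ) + 1) ^ 2) * α₂) ≤ 2)
    (hc₃ : 2 * α₂ ≤ c3 d L) {α₁ : ℝ} {z : Site d} {κ : Fin d}
    (h42 : ‖logCovIter L U₀ (iEta η A) j z κ‖ < 2 * d * L * α₁) :
    ‖linCovIter L U₀ (iEta η A) j z κ‖
      < 2 * d * L * α₁ + 8 * (131072 * ((d : ℝ) + 1) ^ 2)
          * Real.exp (4 * (800 * ((d : ℝ) + 1) ^ 2 * ((d : ℝ) + 4)) * α₀) * α₂ ^ 2 := by
  have hC := eq156_of_141 hη L hL hG j U₀ hU₀ hα₀ hα3 hα4 h40 A hα₂ h41 hsmall hc₃ z κ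
  calc ‖linCovIter L U₀ (iEta η A) j z κ‖
      = ‖logCovIter L U₀ (iEta η A) j z κ
          - (logCovIter L U₀ (iEta η A) j z κ - linCovIter L U₀ (iEta η A) j z κ)‖ := by
        rw [← B1_eq]
    _ ≤ ‖logCovIter L U₀ (iEta η A) j z κ‖
          + ‖logCovIter L U₀ (iEta η A) j z κ - linCovIter L U₀ (iEta η A) j z κ‖ := norm_sub_le _ _
    _ < _ := add_lt_add_of_lt_of_le h42 hC

/-- **«|B₁| < 2dLα₁ + C₂α₂²» for the sup over `Λ_j`**: for any family `bond : ι → Site d × Fin d` of bonds of the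
`j`-lattice on which (1.42) `‖Q_j(U₀, ηA)‖ < 2dLα₁` holds, the sup `|B₁| = sup_i ‖LʲηQ_jA(bond i)‖` (the weight-`1`
instance of `B8Eq155JBound.wsup`) is `≤ 2dLα₁ + C₂α₂²` — the shape of the hypothesis `h56` of `B8.apriori_160`.
[cite: Balaban1985RegularSpaces, p.86 (sentence after (1.56))] -/
theorem wsup_B1_le {η : ℝ} (hη : 0 < η) (L : ℕ) (hL : 2 ≤ L) {G : Subgroup 𝔸ˣ} (hG : AvgClosed d L G) (j : ℕ)
    (U₀ : Site d → Fin d → 𝔸ˣ) (hU₀ : ∀ x κ, U₀ x κ ∈ G) {α₀ : ℝ} (hα₀ : 0 < α₀)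
    (hα3 : C0 d * α₀ ≤ 1 / 3) (hα4 : 4 * α₀ ≤ c2' d L) (h40 : pdev U₀ < α₀ * (((L : ℝ) ^ j)⁻¹) ^ 2)
    (A : Site d → Fin d → 𝔸) {α₂ : ℝ} (hα₂ : 0 ≤ α₂) (h41 : ∀ y κ, ‖A y κ‖ ≤ α₂ * ((L : ℝ) ^ j * η)⁻¹)
    (hsmall : Real.exp (4 * (800 * ((d : ℝ) + 1) ^ 2 * ((d : ℝ) + 4)) * α₀)
      * (1 + 8 * (131072 * ((d : ℝ) + 1) ^ 2) * α₂) ≤ 2)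
    (hc₃ : 2 * α₂ ≤ c3 d L) {α₁ : ℝ} (hα₁ : 0 ≤ α₁) {ι : Type*} (bond : ι → Site d × Fin d)
    (h42 : ∀ i, ‖logCovIter L U₀ (iEta η A) j (bond i).1 (bond i).2‖ < 2 * d * L * α₁) :
    wsup 1 (fun i => linCovIter L U₀ (iEta η A) j (bond i).1 (bond i).2)
      ≤ 2 * d * L * α₁ + 8 * (131072 * ((d : ℝ) + 1) ^ 2)
          * Real.exp (4 * (800 * ((d : ℝ) + 1) ^ 2 * ((d : ℝ) + 4)) * α₀) * α₂ ^ 2 := by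
  have hL' : (0 : ℝ) ≤ (L : ℝ) := Nat.cast_nonneg L
  have hd' : (0 : ℝ) ≤ (d : ℝ) := Nat.cast_nonneg d
  refine wsup_le (fun i => ?_) (by positivity)
  rw [one_mul]
  exact (norm_B1_lt hη L hL hG j U₀ hU₀ hα₀ hα3 hα4 h40 A hα₂ h41 hsmall hc₃ (h42 i)).le

/-! ## §4 The feed: the bootstrap (1.55) ⇒ (1.59) ⇒ (1.60) with (1.56) a theorem -/

omit [NormedAlgebra ℂ 𝔸] [CompleteSpace 𝔸] in
/-- (1.40) for `U₀` at the level `j` in the [3]-Prop.-2 form `pdev U₀ < α₀(Lʲ)⁻²` gives the plaquette input of (1.55) in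
the (1.8) units used by `B8Eq155JBound`: `‖U₀(∂p) − 1‖ ≤ α₀η²((Lʲη)⁻¹)²` at every plaquette (`η > 0`, `U₀` `U1`-valued).
[cite: Balaban1985RegularSpaces, (1.7)–(1.8) p.77, (1.40) p.83] -/
theorem plaq_le_of_pdev {η : ℝ} (hη : 0 < η) {L : ℕ} (hL : 0 < L) {j : ℕ} {U₀ : Site d → Fin d → 𝔸ˣ}
    (h₀ : ∀ y κ, U₀ y κ ∈ U1 𝔸) {α₀ : ℝ} (h40 : pdev U₀ < α₀ * (((L : ℝ) ^ j)⁻¹) ^ 2)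
    (y : Site d) (κ ν : Fin d) :
    ‖plaqF U₀ κ ν y - 1‖ ≤ α₀ * η ^ 2 * (((L : ℝ) ^ j * η)⁻¹) ^ 2 := by
  have hLj : (0 : ℝ) < (L : ℝ) ^ j := by positivity
  have hrw : α₀ * η ^ 2 * (((L : ℝ) ^ j * η)⁻¹) ^ 2 = α₀ * (((L : ℝ) ^ j)⁻¹) ^ 2 := by
    field_simp
  rw [hrw]
  exact ((le_pdev h₀ y κ ν).trans h40.le)

/-- **(1.55) + (1.56) + (1.59) ⇒ (1.60) with `h56` DISCHARGED.**  The tree's `B8Eq155JBound.apriori_160_of_155` ((1.55)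
certified; the four bounds (1.59) of Theorem 3.3 of [4] as real hypotheses on `nJ = |J|_(−3)`, `nB = |B₁|`; «B₀36dα₂ ≦ 1/2»,
`50dα₂ ≤ 1`) in which `nB := sup_i ‖LʲηQ_jA(bond i)‖` over the bonds of `Λ_j` and its bound (1.56)/(1.57)
`nB ≤ 2dLα₁ + C₂α₂²` is the THEOREM `wsup_B1_le` (from (1.42) `‖Q_j(U₀, ηA)‖ < 2dLα₁` on those bonds and [3] Prop. 4),
`C₂ = C₂(d, α₀) = 8C₁e^{4cα₀}`; `U₀` takes values in an averaging-closed `G ≤ U1` and satisfies (1.40) at the level `j` as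
`pdev U₀ < α₀(Lʲ)⁻²` (which also yields the plaquette input of (1.55)).  Output: the four bounds (1.60).
[cite: Balaban1985RegularSpaces, (1.55)–(1.60) p.86] -/
theorem apriori_160_of_156 {η : ℝ} (hη : 0 < η) {L : ℕ} (hL : 2 ≤ L) {G : Subgroup 𝔸ˣ} (hG : AvgClosed d L G)
    {j : ℕ} {U₀ : Site d → Fin d → 𝔸ˣ} (hU₀ : ∀ y κ, U₀ y κ ∈ G)
    {A : Site d → Fin d → 𝔸} (h₁ : ∀ y κ, expCfg (iEta η A) y κ ∈ U1 𝔸) {α₀ α₁ α₂ : ℝ}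
    (hα₀ : 0 < α₀) (hα₁ : 0 ≤ α₁) (hα₂ : 0 ≤ α₂)
    (hα3 : C0 d * α₀ ≤ 1 / 3) (hα4 : 4 * α₀ ≤ c2' d L) (h40 : pdev U₀ < α₀ * (((L : ℝ) ^ j)⁻¹) ^ 2)
    (h41 : ∀ y κ, ‖A y κ‖ ≤ α₂ * ((L : ℝ) ^ j * η)⁻¹)
    (hu : ∀ y κ, ‖(expCfg (iEta η A) y κ : 𝔸) - 1‖ ≤ α₂ * ((L : ℝ) ^ j * η)⁻¹ * η)
    (hsmall16 : 16 * (α₂ * ((L : ℝ) ^ j * η)⁻¹ * η) ≤ 1)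
    (hd5 : 5 * (α₂ * ((L : ℝ) ^ j * η)⁻¹ * η) * ((d : ℝ) - 1) ≤ 4)
    (h40₁ : ∀ (μ : Fin d) (x : Site d),
      ‖covDiv η (mulCfg (expCfg (iEta η A)) U₀) μ x‖ ≤ α₀ * η ^ 2 * (((L : ℝ) ^ j * η)⁻¹) ^ 3)
    (h40₀ : ∀ (μ : Fin d) (x : Site d), ‖covDiv η U₀ μ x‖ ≤ α₀ * η ^ 2 * (((L : ℝ) ^ j * η)⁻¹) ^ 3)
    (hsmall : Real.exp (4 * (800 * ((d : ℝ) + 1) ^ 2 * ((d : ℝ) + 4)) * α₀)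
      * (1 + 8 * (131072 * ((d : ℝ) + 1) ^ 2) * α₂) ≤ 2)
    (hc₃ : 2 * α₂ ≤ c3 d L)
    {ι : Type*} (bond : ι → Site d × Fin d)
    (h42 : ∀ i, ‖logCovIter L U₀ (iEta η A) j (bond i).1 (bond i).2‖ < 2 * d * L * α₁)
    {B₀ a j₂ l : ℝ} (hB₀ : 0 ≤ B₀)
    (h59a : a ≤ B₀ * (jNorm3 η L j U₀ A + wsup 1 (fun i => linCovIter L U₀ (iEta η A) j (bond i).1 (bond i).2)))
    (h59g : gradNorm2 η L j U₀ A
      ≤ B₀ * (jNorm3 η L j U₀ A + wsup 1 (fun i => linCovIter L U₀ (iEta η A) j (bond i).1 (bond i).2)))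
    (h59j : j₂ ≤ B₀ * (jNorm3 η L j U₀ A + wsup 1 (fun i => linCovIter L U₀ (iEta η A) j (bond i).1 (bond i).2)))
    (h59l : l ≤ B₀ * (jNorm3 η L j U₀ A + wsup 1 (fun i => linCovIter L U₀ (iEta η A) j (bond i).1 (bond i).2)))
    (hside : 36 * d * B₀ * α₂ ≤ 1 / 2) (h50 : 50 * d * α₂ ≤ 1) :
    a ≤ B₀ * (4 * α₀ + 4 * d * L * α₁ + 2 * α₂ ^ 2 + 20 * d * α₀ * α₂
      + 2 * (8 * (131072 * ((d : ℝ) + 1) ^ 2) * Real.exp (4 * (800 * ((d : ℝ) + 1) ^ 2 * ((d : ℝ) + 4)) * α₀))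
        * α₂ ^ 2) ∧
    gradNorm2 η L j U₀ A ≤ B₀ * (4 * α₀ + 4 * d * L * α₁ + 2 * α₂ ^ 2 + 20 * d * α₀ * α₂
      + 2 * (8 * (131072 * ((d : ℝ) + 1) ^ 2) * Real.exp (4 * (800 * ((d : ℝ) + 1) ^ 2 * ((d : ℝ) + 4)) * α₀))
        * α₂ ^ 2) ∧
    j₂ ≤ B₀ * (4 * α₀ + 4 * d * L * α₁ + 2 * α₂ ^ 2 + 20 * d * α₀ * α₂
      + 2 * (8 * (131072 * ((d : ℝ) + 1) ^ 2) * Real.exp (4 * (800 * ((d : ℝ) + 1) ^ 2 * ((d : ℝ) + 4)) * α₀))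
        * α₂ ^ 2) ∧
    l ≤ B₀ * (4 * α₀ + 4 * d * L * α₁ + 2 * α₂ ^ 2 + 20 * d * α₀ * α₂
      + 2 * (8 * (131072 * ((d : ℝ) + 1) ^ 2) * Real.exp (4 * (800 * ((d : ℝ) + 1) ^ 2 * ((d : ℝ) + 4)) * α₀))
        * α₂ ^ 2) := by
  have hL0 : 0 < L := lt_of_lt_of_le (by norm_num) hL
  have h₀ : ∀ y κ, U₀ y κ ∈ U1 𝔸 := fun y κ => hG.le_U1 (hU₀ y κ)
  have hp : ∀ (y : Site d) (κ ν : Fin d), κ ≠ ν → ‖plaqF U₀ κ ν y - 1‖ ≤ α₀ * η ^ 2 * (((L : ℝ) ^ j * η)⁻¹) ^ 2 :=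
    fun y κ ν _ => plaq_le_of_pdev hη hL0 h₀ h40 y κ ν
  have h56 := wsup_B1_le hη L hL hG j U₀ hU₀ hα₀ hα3 hα4 h40 A hα₂ h41 hsmall hc₃ hα₁ bond h42
  exact apriori_160_of_155 hη h₀ h₁ hL0 hα₀.le hα₂ h41 hu hp hsmall16 hd5 h40₁ h40₀ hB₀ h56 h59a h59g h59j h59l
    hside h50

/-! ## §5 (v1.1) The companion (1.143) of p. 100, and the Hermitian case of print (`A` self-adjoint, `U₀` unitary)

p. 100 [PDF 26], verbatim (render `…-p026-x2.png`): *"We assume that we are given a gauge field configuration U₀,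
U₀ ∈ 𝔄_k({Ω_j}, α₀), (1.139) and a Lie algebra valued configuration A satisfying Lʲη|A|, (Lʲη)²|∇^η_{U₀}A|,
(Lʲη)³|D^{η*}_{U₀}D^η_{U₀}A| < α₂ on Ω_j. (1.140) … The Proposition 4 from [3] gives also |Q_j(U₀, ηA)| < 2α₂ on Ω_j^{(j)}.
(1.143)"* — the cell's row `B8.Eq1.141` carries «(1.143) enters as hypothesis (B7 Prop 4)»; here it is [3] (131) at a
general background (`norm_logCovIter_le`) in B8's currency. -/

/-- **(1.143)** «The Proposition 4 from [3] gives also |Q_j(U₀, ηA)| < 2α₂ on Ω_j^{(j)}»: under (1.139) at the level `j`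
(`pdev U₀ < α₀(Lʲ)⁻²`, `U₀` in an averaging-closed `G ≤ U1`, [3] Prop. 2 smallness) and the first member of (1.140) read
globally (`‖A‖ ≤ α₂(Lʲη)⁻¹`, `η > 0`), with `e^{4cα₀}(1 + 8C₁α₂) ≤ 2`, `2α₂ ≤ c₃(d, L)`: `‖Q_j(U₀, ηA)(z, κ)‖ ≤ 2α₂` at every
bond of the `j`-lattice. [cite: Balaban1985RegularSpaces, (1.143) p.100] -/
theorem ineq1143 {η : ℝ} (hη : 0 < η) (L : ℕ) (hL : 2 ≤ L) {G : Subgroup 𝔸ˣ} (hG : AvgClosed d L G) (j : ℕ)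
    (U₀ : Site d → Fin d → 𝔸ˣ) (hU₀ : ∀ x κ, U₀ x κ ∈ G) {α₀ : ℝ} (hα₀ : 0 < α₀)
    (hα3 : C0 d * α₀ ≤ 1 / 3) (hα4 : 4 * α₀ ≤ c2' d L) (h139 : pdev U₀ < α₀ * (((L : ℝ) ^ j)⁻¹) ^ 2)
    (A : Site d → Fin d → 𝔸) {α₂ : ℝ} (hα₂ : 0 ≤ α₂) (h140 : ∀ y κ, ‖A y κ‖ ≤ α₂ * ((L : ℝ) ^ j * η)⁻¹)
    (hsmall : Real.exp (4 * (800 * ((d : ℝ) + 1) ^ 2 * ((d : ℝ) + 4)) * α₀)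
      * (1 + 8 * (131072 * ((d : ℝ) + 1) ^ 2) * α₂) ≤ 2)
    (hc₃ : 2 * α₂ ≤ c3 d L) (z : Site d) (κ : Fin d) :
    ‖logCovIter L U₀ (iEta η A) j z κ‖ ≤ 2 * α₂ := by
  have hscale : (L : ℝ) ^ j * (η * (α₂ * ((L : ℝ) ^ j * η)⁻¹)) = α₂ := by
    field_simp
  have ha : 0 ≤ η * (α₂ * ((L : ℝ) ^ j * η)⁻¹) :=
    mul_nonneg hη.le (mul_nonneg hα₂ (inv_nonneg.2 (by positivity)))
  have h := norm_logCovIter_le L hL hG j U₀ hU₀ hα₀ hα3 hα4 h139 (iEta η A) ha (norm_iEta_le hη.le h140)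
    (by rw [hscale]; exact hsmall) (by rw [hscale]; exact hc₃) z κ
  rwa [hscale] at h

end Literature.MathematicalPhysics.QuantumFieldTheory.Balaban1983to89.B8Eq156Prop4

/-! ### The Hermitian case: `A` self-adjoint in a C⋆-algebra, `U₀` unitary (print: `U(N) ⊂ M_N(ℂ)`, `A` `𝔤`-valued) -/

namespace Literature.MathematicalPhysics.QuantumFieldTheory.Balaban1983to89.B8Eq156Prop4

open B7Prop1Explicit (U1)
open B7Prop2Explicit (pdev C0 c2' unitaryUnits avgClosed_unitaryUnits)
open B7Prop3Flat (c3)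
open B7Prop4GeneralLevels (logCovIter linCovIter)
open B8Lemma1NonAbelian (mulCfg)
open B8Ineq132 (covDiv)
open B8Eq146AExpansion (iEta expCfg)
open B8Eq155JBound (wsup jNorm3 gradNorm2 expCfg_iEta_mem_U1 norm_expCfg_iEta_sub_one_le_of_141)

variable {d : ℕ} {𝔸 : Type*} [CStarAlgebra 𝔸] [Nontrivial 𝔸]

/-- **(1.55) + (1.56) + (1.59) ⇒ (1.60) in print's setting** — `U₀` unitary-valued (the unitary group of a non-trivial
C⋆-algebra is averaging-closed, `B7Prop2Explicit.avgClosed_unitaryUnits`) and `A` Hermitian («a Lie algebra valued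
configuration A»): the bootstrap `apriori_160_of_156` with, in addition, the two `U₁ = e^{iηA}` hypotheses `h₁`
(`U1`-valued) and `hu` (`|e^{iηA} − 1| ≤ α₂(Lʲη)⁻¹η`) DISCHARGED by `B8Eq155JBound.expCfg_iEta_mem_U1` /
`norm_expCfg_iEta_sub_one_le_of_141` ((24) of [3]).  What remains assumed is exactly print's (1.40)–(1.42) (global
reading), the smallness of `α₀, α₂`, and the four Theorem-3.3-of-[4] bounds (1.59).
[cite: Balaban1985RegularSpaces, (1.55)–(1.60) p.86] -/
theorem apriori_160_of_156_unitary {η : ℝ} (hη : 0 < η) {L : ℕ} (hL : 2 ≤ L) {j : ℕ}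
    {U₀ : Site d → Fin d → 𝔸ˣ} (hU₀ : ∀ y κ, U₀ y κ ∈ unitaryUnits 𝔸)
    {A : Site d → Fin d → 𝔸} (hAh : ∀ y κ, IsSelfAdjoint (A y κ)) {α₀ α₁ α₂ : ℝ}
    (hα₀ : 0 < α₀) (hα₁ : 0 ≤ α₁) (hα₂ : 0 ≤ α₂)
    (hα3 : C0 d * α₀ ≤ 1 / 3) (hα4 : 4 * α₀ ≤ c2' d L) (h40 : pdev U₀ < α₀ * (((L : ℝ) ^ j)⁻¹) ^ 2)
    (h41 : ∀ y κ, ‖A y κ‖ ≤ α₂ * ((L : ℝ) ^ j * η)⁻¹)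
    (hsmall16 : 16 * (α₂ * ((L : ℝ) ^ j * η)⁻¹ * η) ≤ 1)
    (hd5 : 5 * (α₂ * ((L : ℝ) ^ j * η)⁻¹ * η) * ((d : ℝ) - 1) ≤ 4)
    (h40₁ : ∀ (μ : Fin d) (x : Site d),
      ‖covDiv η (mulCfg (expCfg (iEta η A)) U₀) μ x‖ ≤ α₀ * η ^ 2 * (((L : ℝ) ^ j * η)⁻¹) ^ 3)
    (h40₀ : ∀ (μ : Fin d) (x : Site d), ‖covDiv η U₀ μ x‖ ≤ α₀ * η ^ 2 * (((L : ℝ) ^ j * η)⁻¹) ^ 3)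
    (hsmall : Real.exp (4 * (800 * ((d : ℝ) + 1) ^ 2 * ((d : ℝ) + 4)) * α₀)
      * (1 + 8 * (131072 * ((d : ℝ) + 1) ^ 2) * α₂) ≤ 2)
    (hc₃ : 2 * α₂ ≤ c3 d L)
    {ι : Type*} (bond : ι → Site d × Fin d)
    (h42 : ∀ i, ‖logCovIter L U₀ (iEta η A) j (bond i).1 (bond i).2‖ < 2 * d * L * α₁)
    {B₀ a j₂ l : ℝ} (hB₀ : 0 ≤ B₀)
    (h59a : a ≤ B₀ * (jNorm3 η L j U₀ A + wsup 1 (fun i => linCovIter L U₀ (iEta η A) j (bond i).1 (bond i).2)))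
    (h59g : gradNorm2 η L j U₀ A
      ≤ B₀ * (jNorm3 η L j U₀ A + wsup 1 (fun i => linCovIter L U₀ (iEta η A) j (bond i).1 (bond i).2)))
    (h59j : j₂ ≤ B₀ * (jNorm3 η L j U₀ A + wsup 1 (fun i => linCovIter L U₀ (iEta η A) j (bond i).1 (bond i).2)))
    (h59l : l ≤ B₀ * (jNorm3 η L j U₀ A + wsup 1 (fun i => linCovIter L U₀ (iEta η A) j (bond i).1 (bond i).2)))
    (hside : 36 * d * B₀ * α₂ ≤ 1 / 2) (h50 : 50 * d * α₂ ≤ 1) :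
    a ≤ B₀ * (4 * α₀ + 4 * d * L * α₁ + 2 * α₂ ^ 2 + 20 * d * α₀ * α₂
      + 2 * (8 * (131072 * ((d : ℝ) + 1) ^ 2) * Real.exp (4 * (800 * ((d : ℝ) + 1) ^ 2 * ((d : ℝ) + 4)) * α₀))
        * α₂ ^ 2) ∧
    gradNorm2 η L j U₀ A ≤ B₀ * (4 * α₀ + 4 * d * L * α₁ + 2 * α₂ ^ 2 + 20 * d * α₀ * α₂
      + 2 * (8 * (131072 * ((d : ℝ) + 1) ^ 2) * Real.exp (4 * (800 * ((d : ℝ) + 1) ^ 2 * ((d : ℝ) + 4)) * α₀))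
        * α₂ ^ 2) ∧
    j₂ ≤ B₀ * (4 * α₀ + 4 * d * L * α₁ + 2 * α₂ ^ 2 + 20 * d * α₀ * α₂
      + 2 * (8 * (131072 * ((d : ℝ) + 1) ^ 2) * Real.exp (4 * (800 * ((d : ℝ) + 1) ^ 2 * ((d : ℝ) + 4)) * α₀))
        * α₂ ^ 2) ∧
    l ≤ B₀ * (4 * α₀ + 4 * d * L * α₁ + 2 * α₂ ^ 2 + 20 * d * α₀ * α₂
      + 2 * (8 * (131072 * ((d : ℝ) + 1) ^ 2) * Real.exp (4 * (800 * ((d : ℝ) + 1) ^ 2 * ((d : ℝ) + 4)) * α₀))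
        * α₂ ^ 2) :=
  apriori_160_of_156 hη hL (avgClosed_unitaryUnits d L) hU₀ (expCfg_iEta_mem_U1 η hAh) hα₀ hα₁ hα₂ hα3 hα4 h40
    h41 (norm_expCfg_iEta_sub_one_le_of_141 hη.le hAh h41) hsmall16 hd5 h40₁ h40₀ hsmall hc₃ bond h42 hB₀ h59a h59g
    h59j h59l hside h50

end Literature.MathematicalPhysics.QuantumFieldTheory.Balaban1983to89.B8Eq156Prop4

end
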